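import Summits.NavierStokesRegularity.NavierStokesRegularity.Theorems.LerayQuarterDissipationFiniteDissipationLiouvilleCriticalElement
import HarnessLib

/-!
# Cruxes `FiniteDissipationLiouville` (stmt-22144) / `RecurrentDissipativeLiouville` (stmt-22508):
# the RECURRENT critical element — normal form of a counterexample

Theorems file of route `LerayQuarterDissipation` (seat ns-lqd-p1 g2; `--supports` the child crux
stmt-22508). Navier–Stokes regularity is NOT proved by anything here; no summit is.

Combining the critical element (`…CriticalElement.criticalElement`: least dissipation constant
`K_c`, minimality, near-saturation) with the PROVED child `RecurrentReductionD` in its sharp form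
(p1 g0's `RecurrentReductionD.exists_recurrent_of_persistent_unif`: Birkhoff recurrence in the
orbit closure, SAME constants `C`, `K`): if the crux fails at the Type-I constant `C`, then there is
a member of the stratum which is simultaneously

1. singular at the apex,
2. UNIFORMLY RECURRENT under the Navier–Stokes scaling flow (the hypothesis class of child 22508),
3. CRITICAL: its dissipation constant `K_c` (`K₀ < K_c`) is the least one admitting singular
   members with Type-I constant `C`,
4. NEAR-SATURATING: for every `ε > 0` its dimensionless dissipation `√(−t)∫‖∇w(t)‖²` exceeds
   `K_c − ε` somewhere in every sufficiently long backward log-window (and is `≤ K_c` everywhere).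

So any proof of `RecurrentDissipativeLiouville` may assume (3)–(4) for free, and any refutation of
the line must exhibit such an object (`exists_recurrent_criticalElement`).
-/

noncomputable section

-- the summit and its single sub-problem share the name (CONVENTIONS §1), as in every Theorems file
set_option linter.dupNamespace false

namespace Summit.NavierStokesRegularity.NavierStokesRegularity.Theorems.FiniteDissipationLiouville.CriticalElement

open MeasureTheory Set Filter Topology Metric Function
open Literature.Analysis Literature.Analysis.FluidPDE
open scoped ENNReal NNReal

/-- **The recurrent critical element.** There is an absolute `K₀ > 0` such that whenever some
`𝒟_{C,K}` has a member singular at the apex, there are `K_c ∈ (K₀, K]` and `w ∈ 𝒟_{C,K_c}` which is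
singular at the apex, uniformly recurrent under the scaling flow (the clause of child stmt-22508),
critical (no member of `𝒟_{C,K'}`, `K' < K_c`, is singular) and near-saturating (for every `ε > 0`,
`√(−t)∫‖∇w(t)‖² > K_c − ε` somewhere in every long enough backward log-window). -/
theorem exists_recurrent_criticalElement :
    ∃ K₀ : ℝ, 0 < K₀ ∧ ∀ (C K : ℝ)
      (u : ℝ → EuclideanSpace ℝ (Fin 3) → EuclideanSpace ℝ (Fin 3)), IsTypeIAncientMild C u →
      (∀ s : ℝ, s < 0 → ∫⁻ x, ‖fderiv ℝ (u s) x‖ₑ ^ 2 ≤ ENNReal.ofReal (K / Real.sqrt (-s))) →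
      (∀ r > 0, ∀ M : ℝ, ∃ t ∈ Set.Ioo (-(r ^ 2)) (0 : ℝ),
        ∃ x ∈ Metric.ball (0 : EuclideanSpace ℝ (Fin 3)) r, M < ‖u t x‖) →
      ∃ (Kc : ℝ) (w : ℝ → EuclideanSpace ℝ (Fin 3) → EuclideanSpace ℝ (Fin 3)),
        K₀ < Kc ∧ Kc ≤ K ∧ IsTypeIAncientMild C w ∧
        (∀ s : ℝ, s < 0 → ∫⁻ x, ‖fderiv ℝ (w s) x‖ₑ ^ 2 ≤ ENNReal.ofReal (Kc / Real.sqrt (-s))) ∧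
        (∀ r > 0, ∀ M : ℝ, ∃ t ∈ Set.Ioo (-(r ^ 2)) (0 : ℝ),
          ∃ x ∈ Metric.ball (0 : EuclideanSpace ℝ (Fin 3)) r, M < ‖w t x‖) ∧
        (∀ ε > 0, ∀ R > 1, ∃ L > 0, ∀ a : ℝ, ∃ σ ∈ Set.Icc a (a + L),
          ∀ s ∈ Set.Icc (-(R ^ 2)) (-(R⁻¹) ^ 2),
          ∀ y ∈ Metric.closedBall (0 : EuclideanSpace ℝ (Fin 3)) R,
            ‖Real.exp σ • w (Real.exp (2 * σ) * s) (Real.exp σ • y) - w s y‖ ≤ ε) ∧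
        (∀ K' : ℝ, K' < Kc → ∀ v : ℝ → EuclideanSpace ℝ (Fin 3) → EuclideanSpace ℝ (Fin 3),
          IsTypeIAncientMild C v →
          (∀ s : ℝ, s < 0 → ∫⁻ x, ‖fderiv ℝ (v s) x‖ₑ ^ 2 ≤ ENNReal.ofReal (K' / Real.sqrt (-s))) →
          ¬ (∀ r > 0, ∀ M : ℝ, ∃ t ∈ Set.Ioo (-(r ^ 2)) (0 : ℝ),
            ∃ x ∈ Metric.ball (0 : EuclideanSpace ℝ (Fin 3)) r, M < ‖v t x‖)) ∧
        (∀ ε : ℝ, 0 < ε → ∃ Λ : ℝ, 1 < Λ ∧ ∀ τ : ℝ, τ < 0 →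
          ∃ t ∈ Set.Icc (Λ ^ 2 * τ) (τ / Λ ^ 2),
            ENNReal.ofReal ((Kc - ε) / Real.sqrt (-t)) < ∫⁻ x, ‖fderiv ℝ (w t) x‖ₑ ^ 2) := by
  obtain ⟨K₀, hK₀, hgt⟩ := criticalConstant_gt_gap
  refine ⟨K₀, hK₀, fun C K u hu hlaw hsing => ?_⟩
  obtain ⟨Kc, hKcK, ⟨W, hW, hlawW, hsingW⟩, hmin⟩ := exists_minimal_singular hu hlaw hsing
  -- Birkhoff recurrence in the orbit closure of the critical element, same constants
  obtain ⟨w, hw, hlaww, hrec, hsingw⟩ :=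
    RecurrentReductionD.exists_recurrent_of_persistent_unif hW hlawW
      (fun l hl W' _ hunif _ => RecurrentReductionD.persistent_singularity hW hlawW hsingW l hl W' hunif)
  exact ⟨Kc, w, hgt C Kc w hw hlaww hsingw, hKcK, hw, hlaww, hsingw, hrec, hmin,
    dissipation_nearMax_of_minimal hmin hw hlaww hsingw⟩

/-- **The sharpness of the critical constant** (recorded for convenience): for a minimal `K_c`, a
singular member `W ∈ 𝒟_{C,K_c}` does NOT obey the law with any smaller constant — for every
`K' < K_c` some slice has `K'/√(−s) < ∫ ‖∇W(s)‖²`, i.e. `sup_s √(−s)∫‖∇W(s)‖² = K_c` exactly. -/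
theorem exists_slice_gt_of_minimal {C Kc : ℝ}
    (hmin : ∀ K' : ℝ, K' < Kc → ∀ v : ℝ → EuclideanSpace ℝ (Fin 3) → EuclideanSpace ℝ (Fin 3),
      IsTypeIAncientMild C v →
      (∀ s : ℝ, s < 0 → ∫⁻ x, ‖fderiv ℝ (v s) x‖ₑ ^ 2 ≤ ENNReal.ofReal (K' / Real.sqrt (-s))) →
      ¬ (∀ r > 0, ∀ M : ℝ, ∃ t ∈ Set.Ioo (-(r ^ 2)) (0 : ℝ),
        ∃ x ∈ Metric.ball (0 : EuclideanSpace ℝ (Fin 3)) r, M < ‖v t x‖))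
    {W : ℝ → EuclideanSpace ℝ (Fin 3) → EuclideanSpace ℝ (Fin 3)} (hW : IsTypeIAncientMild C W)
    (hsingW : ∀ r > 0, ∀ M : ℝ, ∃ t ∈ Set.Ioo (-(r ^ 2)) (0 : ℝ),
      ∃ x ∈ Metric.ball (0 : EuclideanSpace ℝ (Fin 3)) r, M < ‖W t x‖)
    {K' : ℝ} (hK' : K' < Kc) :
    ∃ s : ℝ, s < 0 ∧ ENNReal.ofReal (K' / Real.sqrt (-s)) < ∫⁻ x, ‖fderiv ℝ (W s) x‖ₑ ^ 2 := by
  by_contra hcon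
  push Not at hcon
  exact hmin K' hK' W hW hcon hsingW

end Summit.NavierStokesRegularity.NavierStokesRegularity.Theorems.FiniteDissipationLiouville.CriticalElement

end
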